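import Literature.Analysis.FluidPDE.Seregin2020CubicLowerBound
import Literature.Analysis.FluidPDE.Seregin2020BlowupLimit
import Literature.Analysis.FluidPDE.CKNScalingExtras
import HarnessLib

/-!
# Seregin 2020, proof of Theorem 2.1: the blow-up limit at a Type I singular point is a
# non-trivial local energy ancient solution, singular at the origin (properties (𝒜), (2.9))

Analysis/FluidPDE proof file (everything proved; no definitions, no named facts) on the way to
the named fact `Literature.Analysis.FluidPDE.Seregin2020_axisymmetricSingularPoint_typeII`
(`Seregin2020AxisymmetricTypeII.lean`; G. Seregin, Anal. Math. Phys. 10 (2020), Paper 46 =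
arXiv:2006.04140, Thm. 2.1).

The step of the printed proof formalised here (p. 7 of the arXiv version): assuming the origin
is a Type I blow-up, i.e. `g(0) < ∞`, one has `L₀ = sup_{0<r<1}(A + C + E + D)(r) < ∞` ((2.8);
`Seregin2020.typeI_scaledEnergies_bounded`), and "we can rescale our function `v` and `q` around
the origin … Let `λₖ → 0` be a sequence and let `uᵏ(y, s) = λₖ v(x, t)`, `pᵏ(y, s) = λₖ² q(x, t)`,
where `x = λₖ y` and `t = λₖ² s`. Passing `k → ∞`, we can find limit functions `u` and `p` of
sequences `uᵏ` and `pᵏ` that have the properties (𝒜): (i) `u` is a local energy ancient solution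
in `Q₋ = ℝ³ × ]-∞, 0[`, i.e., the pair `u` and `p` is a suitable weak solution in `Q(R)` for any
`R > 0`; … (iii) for any `R > 0`, `A(u,R) + E(u,R) + C(u,R) + D(p,R) ≤ L₀ < ∞`", and "the
velocity `u` is not trivial in the sense `a⁻² ∫_{Q(a)} |u|³ dz ≥ ε(L₀) > 0` for all `0 < a ≤ 1`"
((2.9)).

`Seregin2020.exists_ancientLimit` produces, under the hypotheses of Theorem 2.1 except axial
symmetry and the Type I assumption `g(0) < ∞`: scales `λⱼ → 0`, and a pair `(w, π)` on `ℝ × ℝ³`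
which on every `Q(a)`, `a > 0`, is a suitable weak solution in Albritton–Barker's class
(`IsSuitableWeakSolutionInBall a 0 w π`) with `w ∈ L³(Q(a))`, is the limit of the rescaled pairs
(velocities strongly in `L³(Q(a))`, pressures weakly in `L^{3/2}(Q(a))`), satisfies
`A(w; a), C(w; a), D(π; a) ≤ K` ((𝒜)(iii) for `A, C, D`; the bound for `E` follows on every ball
from the local energy inequality, `Seregin2020.localEnergyBound_top`) and `C(w; a) ≥ κ > 0`
((2.9), all `a > 0`), and whose origin is again a backward singular point (persistence of
singularities, Albritton–Barker 2019, Prop. 2.3). Axial symmetry of the limit ((𝒜)(ii)) and the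
bound `Γ = ϱ u_φ ∈ L_∞` ((2.6)) are not treated here.

Proof: (2.8)–(2.9) for `v` (`Seregin2020.typeI_singular_scaledEnergies`); the pair is in
Albritton–Barker's class on `Q(1)` (`isSuitableWeakSolutionInBall_one`); pre-zooming by `r₁`
normalises the range of scales to `]0, 1]`; the generalised Escauriaza–Seregin–Šverák extraction
`exists_zoom_blowup_limit` (`Seregin2020BlowupLimit.lean`) gives the limit; the bounds pass to
the limit by lower semicontinuity (`cknC_le_of_tendsto_eLpNorm`, `cknAEss_le_of_tendsto_eLpNorm`,
`blowup_cknD_le_of`), the non-triviality by `blowup_lintegral_cube_ge_of`, and the singularity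
by `PersistenceOfSingularities_holds` (each rescaled velocity has infinite `L^∞` norm on every
`Q(R)`, `eLpNorm_top_nsZoom`).

## References

* G. Seregin, Anal. Math. Phys. 10 (2020), Paper 46 = arXiv:2006.04140, proof of Thm. 2.1,
  (2.8)–(2.9) and properties (𝒜). [Seregin2020]
* G. Seregin, T. Shilkin, Russian Math. Surveys 73 (2018), Thm. 3.5. [SereginShilkin2018]
* G. Seregin, *Lecture Notes on Regularity Theory for the Navier–Stokes Equations* (2014),
  Prop. 6.20. [Seregin2014]
* D. Albritton, T. Barker, J. Math. Fluid Mech. 21 (2019), Lemma 2.2, Prop. 2.3.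
  [AlbrittonBarker2019]
-/

noncomputable section

open MeasureTheory Set Function Filter Topology TopologicalSpace Metric
open scoped NNReal ENNReal

namespace Literature.Analysis.FluidPDE

namespace Seregin2020

/-! ### The solution of Theorem 2.1 in Albritton–Barker's class on the unit ball -/

/-- Under the global classes of Def. 1.3 on `Q = 𝒞 × ]-1, 0[`, the pair `(u, p)` is a suitable weak
solution in the unit parabolic ball `Q(0, 1) ⊆ Q` in the class of Albritton–Barker's Def. 2.1
(`IsSuitableWeakSolutionInBall 1 0 u p`). [cite: Seregin2020, Def. 1.3 and §2 (the standing assumptions)] -/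
theorem isSuitableWeakSolutionInBall_one
    {u : ℝ → EuclideanSpace ℝ (Fin 3) → EuclideanSpace ℝ (Fin 3)}
    {p : ℝ → EuclideanSpace ℝ (Fin 3) → ℝ}
    {G : ℝ → EuclideanSpace ℝ (Fin 3) → EuclideanSpace ℝ (Fin 3) →L[ℝ] EuclideanSpace ℝ (Fin 3)}
    (hsw : IsSuitableWeakSolutionOn (SereginSverak2009.parCylOpens 0 1) 1 0 u p)
    (hA : ∃ C : ℝ≥0, ∀ᵐ t ∂(volume.restrict (Ioo (-1 : ℝ) 0)),
      ∫⁻ x in SereginSverak2009.spaceCyl 0 1, ‖u t x‖ₑ ^ 2 ≤ C)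
    (hG : HasWeakSpatialGradientOn (SereginSverak2009.parCylOpens 0 1) u G)
    (hE : ∫⁻ z in SereginSverak2009.parCyl 0 1, ENNReal.ofReal (frobeniusNormSq (G z.1 z.2)) < ∞)
    (hp : ∫⁻ z in SereginSverak2009.parCyl 0 1, ‖p z.1 z.2‖ₑ ^ (3 / 2 : ℝ) < ∞) :
    IsSuitableWeakSolutionInBall 1 0 u p := by
  have hQ : parabolicCylinder 1 (0 : ℝ × EuclideanSpace ℝ (Fin 3)) ⊆
      ((SereginSverak2009.parCylOpens 0 1 : Opens (ℝ × EuclideanSpace ℝ (Fin 3))) :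
        Set (ℝ × EuclideanSpace ℝ (Fin 3))) := by
    rw [SereginSverak2009.coe_parCylOpens]
    exact parabolicCylinder_subset_parCyl 0 1
  have hsub := parabolicCylinder_subset_parCyl (0 : ℝ × EuclideanSpace ℝ (Fin 3)) 1
  have hle : parabolicCylinderOpens 1 (0 : ℝ × EuclideanSpace ℝ (Fin 3)) ≤
      SereginSverak2009.parCylOpens 0 1 := fun w hw => hQ hw
  refine ⟨hsw.of_le hle, ?_, ⟨G, hG.mono hle, (lintegral_mono_set hsub).trans_lt hE⟩, ?_⟩
  · obtain ⟨C, hC⟩ := hA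
    refine ⟨C, ?_⟩
    have e : Ioo ((0 : ℝ × EuclideanSpace ℝ (Fin 3)).1 - 1 ^ 2) (0 : ℝ × EuclideanSpace ℝ (Fin 3)).1 =
        Ioo (-1 : ℝ) 0 := by simp
    rw [e]
    filter_upwards [hC] with t ht
    rw [Prod.snd_zero]
    exact (lintegral_mono_set (ball_subset_spaceCyl 0 1)).trans ht
  · have hpm : AEStronglyMeasurable (uncurry p)
        (volume.restrict (parabolicCylinder 1 (0 : ℝ × EuclideanSpace ℝ (Fin 3)))) :=
      hsw.distributional.2.2.1.aestronglyMeasurable.mono_measure (Measure.restrict_mono hQ le_rfl)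
    have hfin : ∫⁻ z in parabolicCylinder 1 (0 : ℝ × EuclideanSpace ℝ (Fin 3)),
        ‖uncurry p z‖ₑ ^ (3 / 2 : ℝ) ≠ ∞ :=
      ((lintegral_mono_set hsub).trans_lt hp).ne
    exact (memLp_threeHalves_of_lintegral_le hpm hfin le_rfl).1

/-! ### The blow-up limit -/

/-- `stAffine β γ 0 0` fixes the origin. [folklore] -/
theorem stAffine_zero_zero_apply_zero (β γ : ℝ) :
    stAffine β γ (0 : ℝ) (0 : EuclideanSpace ℝ (Fin 3)) (0 : ℝ × EuclideanSpace ℝ (Fin 3)) = 0 :=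
  Prod.ext (by simp [stAffine]) (by simp [stAffine])

/-- **Seregin 2020, proof of Thm. 2.1: the blow-up limit at a Type I singular point**
(properties (𝒜)(i), (iii) for `A, C, D`, the non-triviality (2.9), and the singularity of the
limit at the origin). Let `(u, p)` satisfy the hypotheses of Theorem 2.1 except axial symmetry —
a suitable weak solution of the unforced Navier–Stokes equations (`ν = 1`) on `Q = 𝒞 × ]-1, 0[`
with the global classes of Def. 1.3, `G` a weak spatial gradient, the origin a backward singular
point — and assume the origin is a Type I blow-up, `g(0) < ∞`. Then there are `K < ∞`, `κ > 0`,
scales `λⱼ > 0`, `λⱼ → 0`, and a pair `(w, π)` such that for every `a > 0`: `(w, π)` is a suitable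
weak solution in `Q(a)` (`IsSuitableWeakSolutionInBall a 0 w π`) with `w ∈ L³(Q(a))`; the
rescaled velocities `λⱼ u(λⱼ² s, λⱼ y)` converge to `w` in `L³(Q(a))` and the rescaled pressures
`λⱼ² p(λⱼ² s, λⱼ y)` converge to `π` weakly in `L^{3/2}(Q(a))`;
`A(w; a) ≤ K`, `C(w; a) ≤ K`, `D(π; a) ≤ K` and `C(w; a) ≥ κ`; moreover the origin is a backward
singular point of `w`. [cite: Seregin2020, proof of Thm. 2.1, (2.8)–(2.9) and properties (𝒜)(i),(iii)] -/
theorem exists_ancientLimit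
    {u : ℝ → EuclideanSpace ℝ (Fin 3) → EuclideanSpace ℝ (Fin 3)}
    {p : ℝ → EuclideanSpace ℝ (Fin 3) → ℝ}
    {G : ℝ → EuclideanSpace ℝ (Fin 3) → EuclideanSpace ℝ (Fin 3) →L[ℝ] EuclideanSpace ℝ (Fin 3)}
    (hsw : IsSuitableWeakSolutionOn (SereginSverak2009.parCylOpens 0 1) 1 0 u p)
    (hA : ∃ C : ℝ≥0, ∀ᵐ t ∂(volume.restrict (Ioo (-1 : ℝ) 0)),
      ∫⁻ x in SereginSverak2009.spaceCyl 0 1, ‖u t x‖ₑ ^ 2 ≤ C)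
    (hG : HasWeakSpatialGradientOn (SereginSverak2009.parCylOpens 0 1) u G)
    (hE : ∫⁻ z in SereginSverak2009.parCyl 0 1, ENNReal.ofReal (frobeniusNormSq (G z.1 z.2)) < ∞)
    (hp : ∫⁻ z in SereginSverak2009.parCyl 0 1, ‖p z.1 z.2‖ₑ ^ (3 / 2 : ℝ) < ∞)
    (hsing : IsBackwardSingularPoint u 0) (hI : blowupIndex 0 u G < ∞) :
    ∃ (K : ℝ≥0) (κ : ℝ) (lam : ℕ → ℝ)
      (w : ℝ → EuclideanSpace ℝ (Fin 3) → EuclideanSpace ℝ (Fin 3))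
      (π : ℝ → EuclideanSpace ℝ (Fin 3) → ℝ),
      0 < κ ∧ (∀ j, 0 < lam j) ∧ Tendsto lam atTop (𝓝 0) ∧
      IsBackwardSingularPoint w 0 ∧
      ∀ a : ℝ, 0 < a →
        IsSuitableWeakSolutionInBall a 0 w π ∧
        MemLp (uncurry w) 3
          (volume.restrict (parabolicCylinder a (0 : ℝ × EuclideanSpace ℝ (Fin 3)))) ∧
        Tendsto (fun j => eLpNorm
            (uncurry ((lam j) • stPull ((lam j) ^ 2) (lam j) (0 : ℝ)
              (0 : EuclideanSpace ℝ (Fin 3)) u) - uncurry w) 3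
            (volume.restrict (parabolicCylinder a (0 : ℝ × EuclideanSpace ℝ (Fin 3)))))
          atTop (𝓝 0) ∧
        (∀ g : ℝ × EuclideanSpace ℝ (Fin 3) → ℝ,
          MemLp g 3 (volume.restrict (parabolicCylinder a (0 : ℝ × EuclideanSpace ℝ (Fin 3)))) →
          Tendsto (fun j => ∫ w' in parabolicCylinder a (0 : ℝ × EuclideanSpace ℝ (Fin 3)),
              ((lam j) ^ 2 • stPull ((lam j) ^ 2) (lam j) (0 : ℝ)
                (0 : EuclideanSpace ℝ (Fin 3)) p) w'.1 w'.2 * g w')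
            atTop (𝓝 (∫ w' in parabolicCylinder a (0 : ℝ × EuclideanSpace ℝ (Fin 3)),
              π w'.1 w'.2 * g w'))) ∧
        cknAEss a (0 : ℝ × EuclideanSpace ℝ (Fin 3)) w ≤ K ∧
        cknC a (0 : ℝ × EuclideanSpace ℝ (Fin 3)) w ≤ K ∧
        cknD a (0 : ℝ × EuclideanSpace ℝ (Fin 3)) π ≤ K ∧
        ENNReal.ofReal κ ≤ cknC a (0 : ℝ × EuclideanSpace ℝ (Fin 3)) w := by
  classical
  -- ### (2.8)–(2.9) for `v`, and the class on the unit ball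
  obtain ⟨K, κ, hκ, r₁, hr₁, hr₁1, hKκ⟩ := typeI_singular_scaledEnergies hsw hA hG hE hp hsing hI
  have hball := isSuitableWeakSolutionInBall_one hsw hA hG hE hp
  have hQ : parabolicCylinder 1 (0 : ℝ × EuclideanSpace ℝ (Fin 3)) ⊆
      ((SereginSverak2009.parCylOpens 0 1 : Opens (ℝ × EuclideanSpace ℝ (Fin 3))) :
        Set (ℝ × EuclideanSpace ℝ (Fin 3))) := by
    rw [SereginSverak2009.coe_parCylOpens]
    exact parabolicCylinder_subset_parCyl 0 1
  -- ### the pre-zoomed pair `v' = r₁ u(r₁² s, r₁ y)`, `p' = r₁² p(r₁² s, r₁ y)`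
  set z₀ : ℝ × EuclideanSpace ℝ (Fin 3) := ((0 : ℝ), (0 : EuclideanSpace ℝ (Fin 3))) with hz₀
  have hz₀0 : z₀ = 0 := rfl
  set v' : ℝ → EuclideanSpace ℝ (Fin 3) → EuclideanSpace ℝ (Fin 3) :=
    r₁ • stPull (r₁ ^ 2) r₁ (0 : ℝ) (0 : EuclideanSpace ℝ (Fin 3)) u with hv'
  set p' : ℝ → EuclideanSpace ℝ (Fin 3) → ℝ :=
    r₁ ^ 2 • stPull (r₁ ^ 2) r₁ (0 : ℝ) (0 : EuclideanSpace ℝ (Fin 3)) p with hp'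
  have hzoomv : ∀ c : ℝ, c • stPull (c ^ 2) c z₀.1 z₀.2 v' =
      (c * r₁) • stPull ((c * r₁) ^ 2) (c * r₁) (0 : ℝ) (0 : EuclideanSpace ℝ (Fin 3)) u := by
    intro c
    show c • stPull (c ^ 2) c 0 0 v' = _
    rw [hv', zoom_zoom]
  have hzoomp : ∀ c : ℝ, c ^ 2 • stPull (c ^ 2) c z₀.1 z₀.2 p' =
      (c * r₁) ^ 2 • stPull ((c * r₁) ^ 2) (c * r₁) (0 : ℝ) (0 : EuclideanSpace ℝ (Fin 3)) p := by
    intro c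
    show c ^ 2 • stPull (c ^ 2) c 0 0 p' = _
    rw [hp', zoom_zoom, mul_pow]
  have hst : ∀ β γ : ℝ, stAffine β γ z₀.1 z₀.2 (0 : ℝ × EuclideanSpace ℝ (Fin 3)) = z₀ := by
    intro β γ
    rw [hz₀0]
    exact stAffine_zero_zero_apply_zero β γ
  -- ### the three inputs of the extraction
  have hu_meas : AEStronglyMeasurable (uncurry u)
      (volume.restrict (parabolicCylinder (1 / 2) z₀)) := by
    refine (hG.locallyIntegrableOn.aestronglyMeasurable).mono_measure (Measure.restrict_mono ?_ le_rfl)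
    rw [hz₀0]
    exact (parabolicCylinder_mono (by norm_num) (by norm_num) _).trans hQ
  have hp_meas : AEStronglyMeasurable (uncurry p)
      (volume.restrict (parabolicCylinder (1 / 2) z₀)) := by
    refine hsw.distributional.2.2.1.aestronglyMeasurable.mono_measure (Measure.restrict_mono ?_ le_rfl)
    rw [hz₀0]
    exact (parabolicCylinder_mono (by norm_num) (by norm_num) _).trans hQ
  have hr₁half : 1 / 2 * r₁ ≤ 1 / 2 := by linarith
  have hv'_meas : AEStronglyMeasurable (uncurry v')
      (volume.restrict (parabolicCylinder (1 / 2) z₀)) := by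
    have h1 := aestronglyMeasurable_uncurry_zoom_of hu_meas hr₁ (by norm_num : (0 : ℝ) < 1 / 2)
      hr₁half
    rw [hz₀0]
    exact h1
  have hp'_meas : AEStronglyMeasurable (uncurry p')
      (volume.restrict (parabolicCylinder (1 / 2) z₀)) := by
    have h1 := aestronglyMeasurable_uncurry_zoom_pressure_of hp_meas hr₁
      (by norm_num : (0 : ℝ) < 1 / 2) hr₁half
    rw [hz₀0]
    exact h1
  have hsuit : ∀ c ∈ Ioc (0 : ℝ) (1 / 2), IsSuitableWeakSolutionInBall 1 0
      (c • stPull (c ^ 2) c z₀.1 z₀.2 v') (c ^ 2 • stPull (c ^ 2) c z₀.1 z₀.2 p') := by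
    intro c hc
    have hcr : 0 < c * r₁ := mul_pos hc.1 hr₁
    have h1 := hball.zoomOut hcr
    have hle : (1 : ℝ) ≤ 1 / (c * r₁) := by
      rw [le_div_iff₀ hcr, one_mul]
      nlinarith [hc.1, hc.2, hr₁, hr₁1]
    have h2 := SuitableCompactness.isSuitableWeakSolutionInBall_of_le_radius h1 one_pos hle
    rw [hzoomv, hzoomp]
    exact h2
  -- the scaled quantities of `v'` are those of `u` at the scales `r r₁ ≤ r₁`
  have hscale : ∀ r ∈ Ioc (0 : ℝ) 1, r₁ * r ∈ Ioc (0 : ℝ) r₁ := fun r hr =>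
    ⟨mul_pos hr₁ hr.1, mul_le_of_le_one_right hr₁.le hr.2⟩
  have hCv' : ∀ r : ℝ, 0 < r → cknC r z₀ v' = cknC (r₁ * r) (0 : ℝ × EuclideanSpace ℝ (Fin 3)) u := by
    intro r hr
    rw [hv', hz₀0, cknC_nsZoom hr₁ hr, stAffine_zero_zero_apply_zero]
  have hDv' : ∀ r : ℝ, 0 < r → cknD r z₀ p' = cknD (r₁ * r) (0 : ℝ × EuclideanSpace ℝ (Fin 3)) p := by
    intro r hr
    rw [hp', hz₀0, cknD_nsZoom hr₁ hr, stAffine_zero_zero_apply_zero]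
  have hAv' : ∀ r : ℝ, 0 < r → cknAEss r z₀ v' = cknAEss (r₁ * r) (0 : ℝ × EuclideanSpace ℝ (Fin 3)) u := by
    intro r hr
    rw [hv', hz₀0, cknAEss_nsZoom hr₁ hr, stAffine_zero_zero_apply_zero]
  have hM : ∀ r ∈ Ioc (0 : ℝ) (1 / 2), cknC r z₀ v' ≤ K := by
    intro r hr
    rw [hCv' r hr.1]
    have h := (hKκ (r₁ * r) (hscale r ⟨hr.1, hr.2.trans (by norm_num)⟩)).1
    exact (le_add_self.trans le_self_add).trans h
  have hD : ∀ r ∈ Ioc (0 : ℝ) (1 / 2), cknD r z₀ p' ≤ K := by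
    intro r hr
    rw [hDv' r hr.1]
    exact le_add_self.trans (hKκ (r₁ * r) (hscale r ⟨hr.1, hr.2.trans (by norm_num)⟩)).1
  have hη : ∀ ρ ∈ Ioc (0 : ℝ) (1 / 2), ENNReal.ofReal κ ≤ cknC ρ z₀ v' := by
    intro ρ hρ
    rw [hCv' ρ hρ.1]
    exact (hKκ (r₁ * ρ) (hscale ρ ⟨hρ.1, hρ.2.trans (by norm_num)⟩)).2
  -- ### the extraction
  obtain ⟨δ, w, π, hδ, hδge, hlim⟩ := exists_zoom_blowup_limit hv'_meas hsuit hM hD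
  set mu : ℕ → ℝ := fun j => (1 / 2 : ℝ) ^ (δ j + 2) with hmu
  have hmu_pos : ∀ j, 0 < mu j := fun j => by positivity
  have hmu_le : ∀ j, mu j ≤ 1 / 4 := fun j => by
    show (1 / 2 : ℝ) ^ (δ j + 2) ≤ 1 / 4
    calc (1 / 2 : ℝ) ^ (δ j + 2) ≤ (1 / 2) ^ 2 :=
          pow_le_pow_of_le_one (by norm_num) (by norm_num) (by omega)
      _ = 1 / 4 := by norm_num
  have hmu_lim : Tendsto mu atTop (𝓝 0) := by
    have h2 : Tendsto (fun j => δ j + 2) atTop atTop :=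
      (tendsto_add_atTop_nat 2).comp hδ.tendsto_atTop
    exact (tendsto_pow_atTop_nhds_zero_of_lt_one (by norm_num) (by norm_num)).comp h2
  refine ⟨K, κ, fun j => mu j * r₁, w, π, hκ, fun j => mul_pos (hmu_pos j) hr₁, ?_, ?_, ?_⟩
  · -- `λⱼ → 0`
    have := hmu_lim.mul_const r₁
    rwa [zero_mul] at this
  · -- ### the origin is a singular point of the limit (persistence of singularities)
    have hsuit' : ∀ k, IsSuitableWeakSolutionInBall 1 0
        (mu k • stPull (mu k ^ 2) (mu k) z₀.1 z₀.2 v') (mu k ^ 2 • stPull (mu k ^ 2) (mu k) z₀.1 z₀.2 p') :=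
      fun k => hsuit (mu k) ⟨hmu_pos k, (hmu_le k).trans (by norm_num)⟩
    have hbound : (⨆ k, eLpNorm (uncurry (mu k • stPull (mu k ^ 2) (mu k) z₀.1 z₀.2 v')) 3
          (volume.restrict (parabolicCylinder 1 (0 : ℝ × EuclideanSpace ℝ (Fin 3)))) +
        eLpNorm (uncurry (mu k ^ 2 • stPull (mu k ^ 2) (mu k) z₀.1 z₀.2 p')) (3 / 2)
          (volume.restrict (parabolicCylinder 1 (0 : ℝ × EuclideanSpace ℝ (Fin 3))))) < ∞ := by
      refine lt_of_le_of_lt (iSup_le fun k => eLpNorm_zoom_add_le_of hM hD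
        ⟨hmu_pos k, (hmu_le k).trans (by norm_num)⟩) ?_
      exact ENNReal.add_lt_top.2
        ⟨ENNReal.rpow_lt_top_of_nonneg (by norm_num) ENNReal.coe_ne_top,
          ENNReal.rpow_lt_top_of_nonneg (by norm_num) ENNReal.coe_ne_top⟩
    have hconvR : ∀ R ∈ Ioo (0 : ℝ) 1,
        IsSuitableWeakSolutionInBall R 0 w π ∧
        Tendsto (fun k => eLpNorm (uncurry (mu k • stPull (mu k ^ 2) (mu k) z₀.1 z₀.2 v') - uncurry w) 3
          (volume.restrict (parabolicCylinder R (0 : ℝ × EuclideanSpace ℝ (Fin 3))))) atTop (𝓝 0) ∧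
        ∀ g : ℝ × EuclideanSpace ℝ (Fin 3) → ℝ,
          MemLp g 3 (volume.restrict (parabolicCylinder R (0 : ℝ × EuclideanSpace ℝ (Fin 3)))) →
          Tendsto (fun k => ∫ w' in parabolicCylinder R (0 : ℝ × EuclideanSpace ℝ (Fin 3)),
              (mu k ^ 2 • stPull (mu k ^ 2) (mu k) z₀.1 z₀.2 p') w'.1 w'.2 * g w')
            atTop (𝓝 (∫ w' in parabolicCylinder R (0 : ℝ × EuclideanSpace ℝ (Fin 3)),
              π w'.1 w'.2 * g w')) := by
      intro R hR
      obtain ⟨h1, -, h3, h4⟩ := hlim R hR.1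
      exact ⟨h1, h3, h4⟩
    have hblow : ∀ R ∈ Ioo (0 : ℝ) 1, limsup (fun k => eLpNorm
        (uncurry (mu k • stPull (mu k ^ 2) (mu k) z₀.1 z₀.2 v')) ∞
          (volume.restrict (parabolicCylinder R (0 : ℝ × EuclideanSpace ℝ (Fin 3))))) atTop = ∞ := by
      intro R hR
      have hall : ∀ k, eLpNorm (uncurry (mu k • stPull (mu k ^ 2) (mu k) z₀.1 z₀.2 v')) ∞
          (volume.restrict (parabolicCylinder R (0 : ℝ × EuclideanSpace ℝ (Fin 3)))) = ∞ := by
        intro k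
        rw [hzoomv, eLpNorm_top_nsZoom (mul_pos (hmu_pos k) hr₁), stAffine_zero_zero_apply_zero,
          hsing _ (by have := hmu_pos k; have := hR.1; positivity), ENNReal.mul_top]
        exact (ENNReal.ofReal_pos.2 (mul_pos (hmu_pos k) hr₁)).ne'
      simp only [hall]
      exact limsup_const ∞
    exact PersistenceOfSingularities_holds _ _ w π hsuit' hbound hconvR hblow
  · -- ### the properties on `Q(a)`
    intro a ha
    obtain ⟨h1, h2, h3, h4⟩ := hlim a ha
    have hμa := eventually_scale_mul_le_half hδge ha
    obtain ⟨j₀, hj₀⟩ := hμa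
    -- measurability of the rescaled velocities on `Q(a)` for `j ≥ j₀`
    have hmeas : ∀ j, j₀ ≤ j → AEStronglyMeasurable
        (uncurry (mu j • stPull (mu j ^ 2) (mu j) z₀.1 z₀.2 v'))
        (volume.restrict (parabolicCylinder a (0 : ℝ × EuclideanSpace ℝ (Fin 3)))) :=
      fun j hj => aestronglyMeasurable_uncurry_zoom_of hv'_meas (hmu_pos j) ha (hj₀ j hj)
    have hw_meas : AEStronglyMeasurable (uncurry w)
        (volume.restrict (parabolicCylinder a (0 : ℝ × EuclideanSpace ℝ (Fin 3)))) := h2.1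
    -- the shifted sequence `j ↦ j₀ + j`
    have h3' := (tendsto_add_atTop_iff_nat (f := fun j => eLpNorm
        (uncurry (mu j • stPull (mu j ^ 2) (mu j) z₀.1 z₀.2 v') - uncurry w) 3
          (volume.restrict (parabolicCylinder a (0 : ℝ × EuclideanSpace ℝ (Fin 3))))) j₀).2 h3
    -- scales `r₁ μⱼ a ≤ r₁`
    have hsc : ∀ j, j₀ ≤ j → r₁ * (mu j * a) ∈ Ioc (0 : ℝ) r₁ := by
      intro j hj
      refine ⟨by have := hmu_pos j; positivity, mul_le_of_le_one_right hr₁.le ?_⟩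
      have := hj₀ j hj
      rw [mul_comm] at this
      linarith
    refine ⟨h1, h2, ?_, ?_, ?_, ?_, ?_, ?_⟩
    · -- strong convergence of the velocities
      refine (tendsto_congr fun j => ?_).1 h3
      rw [hzoomv]
    · -- weak convergence of the pressures
      intro g hg
      have := h4 g hg
      refine (tendsto_congr fun j => ?_).1 this
      rw [hzoomp]
    · -- `A(w; a) ≤ K`
      refine cknAEss_le_of_tendsto_eLpNorm ha subset_rfl (fun k => hmeas (k + j₀) (Nat.le_add_left _ _))
        hw_meas h3' fun k => ?_
      rw [cknAEss_nsZoom (hmu_pos _) ha, hst, hAv' _ (by have := hmu_pos (k + j₀); positivity)]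
      have h := (hKκ _ (hsc (k + j₀) (Nat.le_add_left _ _))).1
      exact (le_self_add.trans (le_self_add.trans le_self_add)).trans h
    · -- `C(w; a) ≤ K`
      refine cknC_le_of_tendsto_eLpNorm ha subset_rfl (fun k => hmeas (k + j₀) (Nat.le_add_left _ _))
        hw_meas h3' fun k => ?_
      rw [cknC_nsZoom (hmu_pos _) ha, hst, hCv' _ (by have := hmu_pos (k + j₀); positivity)]
      have h := (hKκ _ (hsc (k + j₀) (Nat.le_add_left _ _))).1
      exact (le_add_self.trans le_self_add).trans h
    · -- `D(π; a) ≤ K`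
      exact blowup_cknD_le_of hp'_meas hδge hD ha h1.2.2.2 h4
    · -- `C(w; a) ≥ κ`
      have hlow := blowup_lintegral_cube_ge_of hv'_meas hδge hη ha hw_meas h3
      have ha2 : (ENNReal.ofReal a ^ 2) ≠ 0 := pow_ne_zero _ ((ENNReal.ofReal_pos.2 ha).ne')
      have ha2' : (ENNReal.ofReal a ^ 2) ≠ ∞ := ENNReal.pow_ne_top ENNReal.ofReal_ne_top
      rw [cknC]
      refine (ENNReal.mul_le_iff_le_inv ha2 ha2').1 ?_
      rw [← ENNReal.ofReal_pow ha.le, ← ENNReal.ofReal_mul (by positivity)]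
      exact hlow

end Seregin2020

end Literature.Analysis.FluidPDE

end
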